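import Mathlib
import HarnessLib
import Summits.CriticalPhenomena.CardyFormulaZ2.Theorems.CardyMagicRigidityMagicFormulaTCloseComparisonMatching

/-!
# Existence of `lim_δ E_{1/2}[A₁²]` modulo CN + SW — part 2/3: the deterministic comparison
(crux `MagicFormulaT`, line `Sketch` v10, sub-goal `el_existsLimitA1sq_of_facts`)

Crux `Summit.CriticalPhenomena.CardyFormulaZ2.Theses.CardyMagicRigidity.MagicFormulaT`
(stmt-CriticalPhenomena-4836), line `Sketch`, skeleton v10, wave 5, registered sub-goal
`el_existsLimitA1sq_of_facts` (existence of `lim_δ E_{1/2}[A₁²]`, `A₁ = Σ_u θ_u`, modulo Camia–Newman and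
Smirnov–Werner).  This second file is the deterministic heart of the Cauchy argument for the functional
`X̄² = (m⁻¹ Σ_{j<m} X_{η_j})²`, `X_t(c) = Σ_{u ∈ c.bigLoops t} θ_u` (big-loop PHASE SUM), `θ_u = u.nestingPhase f`,
thresholds `η_j = η/2 + (j+1)η/(2m) ∈ (η/2, η]` — registered helper `ela1_comparison`, stated under EXACTLY the
hypotheses of lead c3's `stub_closeComparison` (v7): `f` admissible (`|f| ≤ C`, `f = 0` off `B̄(0,R)`, measurable,
`∫ f = 0`); `c, c'` two configurations with `d_CN(c, c') ≤ ε` (`LoopConfig.IsClose ε c c'`); the RELEVANT loops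
(meeting `B̄(0, R+1)`, diameter `≥ η/5`) of `c` and of `c'` finitely many (`≤ N₀`), inside the window `B(0, 1/ε)`,
pairwise `2ε`-separated (ribbon-free); the `ε`-sausage of every relevant loop of `c` of area `≤ τ` in `B̄(0, R)`;
`8mε ≤ η`.

**Theorem** (`ela1_comparison`).  `|X̄(c)² − X̄(c')²| ≤ 2 N₀² K (Cτ + 2πCη²/m)`, `K = C · Leb(B̄(0,R))`.

**Proof.**  (1) MATCHING, verbatim from c3 (`cc_pair_rel`, `cc_eq_of_udist_le`, `cc_exists_partner`): the set `P`
of pairs `(x, y) ∈ c.loops × c'.loops` with `d(x,y) ≤ ε`, one of them meeting `B̄(0,R)` with `diam ≥ η/2`, is a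
partial bijection between relevant loops, `#P ≤ N₀`, and covers every loop of `c` (resp. `c'`) meeting `B̄(0,R)` of
diameter `≥ η/2`; only such loops have `θ ≠ 0` at a threshold `t ≥ η/2` (`nestingPhase_eq_zero_of_disjoint`), so
`X_t(c) = Σ_{(x,y) ∈ P} a_t(x)`, `X_t(c') = Σ_{(x,y) ∈ P} a_t(y)`, `a_t(u) = [t ≤ diam u] θ_u` (`ela1_bigSum_eq_sum`).
(2) PER PAIR (`ela1_sum_abs_sub_le`): `|a_t(x) − a_t(y)| ≤ Cτ` when both are big
(`abs_nestingPhase_sub_le_of_udist_le`), `= 0` when both are small, `≤ |θ| ≤ πC(5η/4)² ≤ 2πCη²` in the mixed case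
(then the big one has `diam ≤ t + 2ε ≤ 5η/4`, `uva_abs_nestingPhase_le_sq`), which occurs for AT MOST ONE threshold
(`cc_threshold_unique`); so `Σ_j |a_j(x) − a_j(y)| ≤ mCτ + 2πCη²`.  (3) SUMS: `|X̄(c) − X̄(c')| ≤ N₀(Cτ + 2πCη²/m)`
(`ela1_abs_avg_sub_avg_le`), `|X̄(c)|, |X̄(c')| ≤ N₀K` (`|θ_u| ≤ K`, `abs_nestingPhase_le_mul_volume_closedBall`,
`ela1_abs_avg_le`), and `|a² − b²| = |a + b||a − b|`.

Everything is proved from tree material; no definition, no cited fact.  Helper prefix `ela1_`.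
-/

noncomputable section

namespace Summit.CriticalPhenomena.CardyFormulaZ2.Cruxes.MagicFormulaT.LineSketch

open MeasureTheory Filter Set Metric
open scoped Real Topology BigOperators ENNReal
open Literature.Probability.RandomPlanarGeometry Literature.Probability.Percolation
  Literature.Probability.LatticeModels

/-! ## §1 Per matched pair: the sum over thresholds of the phase differences -/

section Pair

variable {f : ℂ → ℝ} {R C : ℝ}

/-- The mixed-case bound: a loop of diameter `≤ 5η/4` has `|θ_u| ≤ 2πCη²` (`|θ_u| ≤ πC diam²`). -/
theorem ela1_abs_nestingPhase_le_of_diam_le (hC : ∀ z, |f z| ≤ C) (hR : ∀ z, R < ‖z‖ → f z = 0)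
    {η : ℝ} {u : UnbasedLoop ℂ} (hu : diam u.range ≤ 5 * η / 4) :
    |u.nestingPhase f| ≤ 2 * π * C * η ^ 2 := by
  have hC0 : 0 ≤ C := nonneg_of_abs_le hC
  have hπC : 0 ≤ π * C := mul_nonneg Real.pi_pos.le hC0
  have hd2 : diam u.range ^ 2 ≤ (5 * η / 4) ^ 2 := pow_le_pow_left₀ diam_nonneg hu 2
  calc |u.nestingPhase f| ≤ π * C * diam u.range ^ 2 := uva_abs_nestingPhase_le_sq hC hR u
    _ ≤ π * C * (5 * η / 4) ^ 2 := mul_le_mul_of_nonneg_left hd2 hπC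
    _ ≤ 2 * π * C * η ^ 2 := by nlinarith [mul_nonneg hπC (sq_nonneg η)]

/-- **Per-pair estimate for the phases.**  For two loops `x, y` at unoriented distance `d(x, y) ≤ ε` whose
`ε`-sausage (of `x`) has area `≤ τ` in `B̄(0, R)`, with `8mε ≤ η`, `0 < m`: the sum over the `m` thresholds `η_j`
of `|a_j(x) − a_j(y)|`, `a_j(u) = [η_j ≤ diam u] θ_u`, is at most `m · Cτ + 2πCη²` (both big: `Cτ` by
`abs_nestingPhase_sub_le_of_udist_le`; both small: `0`; mixed: `≤ 2πCη²`, at most once by `cc_threshold_unique`). -/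
theorem ela1_sum_abs_sub_le (hf : Measurable f) (hC : ∀ z, |f z| ≤ C) (hR : ∀ z, R < ‖z‖ → f z = 0)
    {x y : UnbasedLoop ℂ} {ε η τ : ℝ} {m : ℕ} (hε : 0 < ε) (hm : 0 < m) (hmε : 8 * m * ε ≤ η)
    (hxy : x.udist y ≤ ε)
    (hV : volume.real ({z : ℂ | infDist z x.range ≤ ε} ∩ closedBall (0 : ℂ) R) ≤ τ) :
    ∑ j ∈ Finset.range m,
      |(if η / 2 + ((j : ℝ) + 1) * η / (2 * m) ≤ diam x.range then x.nestingPhase f else 0) -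
        (if η / 2 + ((j : ℝ) + 1) * η / (2 * m) ≤ diam y.range then y.nestingPhase f else 0)| ≤
      m * (C * τ) + 2 * π * C * η ^ 2 := by
  classical
  have hC0 : 0 ≤ C := nonneg_of_abs_le hC
  have hτ : 0 ≤ τ := le_trans measureReal_nonneg hV
  have hεη : 8 * ε ≤ η := by
    have : (1 : ℝ) ≤ m := by exact_mod_cast hm
    nlinarith
  have hη : 0 ≤ η := by linarith
  have hdx : diam x.range ≤ diam y.range + 2 * ε := UnbasedLoop.diam_range_le_of_udist_le x y hxy
  have hdy : diam y.range ≤ diam x.range + 2 * ε :=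
    UnbasedLoop.diam_range_le_of_udist_le y x (by rwa [UnbasedLoop.udist_comm])
  have hfac : |x.nestingPhase f - y.nestingPhase f| ≤ C * τ :=
    (abs_nestingPhase_sub_le_of_udist_le hf hC hR hxy).trans (mul_le_mul_of_nonneg_left hV hC0)
  -- the mixed thresholds
  set mixed : ℕ → Prop := fun j ↦
    (η / 2 + ((j : ℝ) + 1) * η / (2 * m) ≤ diam x.range ∧
        ¬ η / 2 + ((j : ℝ) + 1) * η / (2 * m) ≤ diam y.range) ∨
      (¬ η / 2 + ((j : ℝ) + 1) * η / (2 * m) ≤ diam x.range ∧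
        η / 2 + ((j : ℝ) + 1) * η / (2 * m) ≤ diam y.range) with hmixed
  have hterm : ∀ j ∈ Finset.range m,
      |(if η / 2 + ((j : ℝ) + 1) * η / (2 * m) ≤ diam x.range then x.nestingPhase f else 0) -
          (if η / 2 + ((j : ℝ) + 1) * η / (2 * m) ≤ diam y.range then y.nestingPhase f else 0)| ≤
        C * τ + if mixed j then 2 * π * C * η ^ 2 else 0 := by
    intro j hj
    have hTj : η / 2 + ((j : ℝ) + 1) * η / (2 * m) ≤ η := cc_threshold_le hη hj
    have hCτ : 0 ≤ C * τ := by positivity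
    by_cases hx : η / 2 + ((j : ℝ) + 1) * η / (2 * m) ≤ diam x.range <;>
      by_cases hy : η / 2 + ((j : ℝ) + 1) * η / (2 * m) ≤ diam y.range
    · -- both big
      have hnm : ¬ mixed j := by
        rintro (⟨-, h⟩ | ⟨h, -⟩)
        · exact h hy
        · exact h hx
      rw [if_pos hx, if_pos hy, if_neg hnm, add_zero]
      exact hfac
    · -- `x` big, `y` small
      have hmx : mixed j := Or.inl ⟨hx, hy⟩
      rw [if_pos hx, if_neg hy, if_pos hmx, sub_zero]
      have hdx' : diam x.range ≤ 5 * η / 4 := by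
        push Not at hy
        linarith
      linarith [ela1_abs_nestingPhase_le_of_diam_le (f := f) hC hR hdx']
    · -- `x` small, `y` big
      have hmx : mixed j := Or.inr ⟨hx, hy⟩
      rw [if_neg hx, if_pos hy, if_pos hmx, zero_sub, abs_neg]
      have hdy' : diam y.range ≤ 5 * η / 4 := by
        push Not at hx
        linarith
      linarith [ela1_abs_nestingPhase_le_of_diam_le (f := f) hC hR hdy']
    · -- both small
      have hnm : ¬ mixed j := by
        rintro (⟨h, -⟩ | ⟨-, h⟩)
        · exact hx h
        · exact hy h
      rw [if_neg hx, if_neg hy, if_neg hnm, sub_self, abs_zero, add_zero]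
      exact hCτ
  have hcard : ((Finset.range m).filter mixed).card ≤ 1 :=
    Finset.card_le_one.2 fun a ha b hb ↦ by
      rw [Finset.mem_filter] at ha hb
      exact cc_threshold_unique hε hmε hdx hdy ha.1 ha.2 hb.2
  calc ∑ j ∈ Finset.range m,
        |(if η / 2 + ((j : ℝ) + 1) * η / (2 * m) ≤ diam x.range then x.nestingPhase f else 0) -
          (if η / 2 + ((j : ℝ) + 1) * η / (2 * m) ≤ diam y.range then y.nestingPhase f else 0)|
      ≤ ∑ j ∈ Finset.range m, (C * τ + if mixed j then 2 * π * C * η ^ 2 else 0) :=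
        Finset.sum_le_sum hterm
    _ = m * (C * τ) + 2 * π * C * η ^ 2 * ((Finset.range m).filter mixed).card := by
        rw [Finset.sum_add_distrib, Finset.sum_const, Finset.card_range, nsmul_eq_mul,
          ← Finset.sum_filter, Finset.sum_const, nsmul_eq_mul]
        ring
    _ ≤ m * (C * τ) + 2 * π * C * η ^ 2 * 1 := by
        have h1 : ((((Finset.range m).filter mixed).card : ℕ) : ℝ) ≤ 1 := by exact_mod_cast hcard
        have h2 : 0 ≤ 2 * π * C * η ^ 2 :=
          mul_nonneg (mul_nonneg (mul_nonneg zero_le_two Real.pi_pos.le) hC0) (sq_nonneg η)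
        exact add_le_add le_rfl (mul_le_mul_of_nonneg_left h1 h2)
    _ = m * (C * τ) + 2 * π * C * η ^ 2 := by ring

end Pair

/-! ## §2 The big-loop phase sum as a finite sum over the matched pairs -/

/-- **The big-loop phase sum at a threshold `t ≥ s` is a finite sum over an injectively labelled family covering
the loops meeting `B̄(0, R)` of diameter `≥ s`**: the other big loops have phase `0`
(`nestingPhase_eq_zero_of_disjoint`), and the labelled loops of diameter `< t` are given the term `0` by hand. -/
theorem ela1_bigSum_eq_sum {ι : Type*} {f : ℂ → ℝ} {R : ℝ} (hR : ∀ z, R < ‖z‖ → f z = 0)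
    (h0 : ∫ z, f z = 0) (d : LoopConfig ℂ) (P : Finset ι) (proj : ι → UnbasedLoop ℂ)
    (hinj : Set.InjOn proj ↑P) (hmem : ∀ p ∈ P, proj p ∈ d.loops) {s t : ℝ} (hst : s ≤ t)
    (hcov : ∀ x ∈ d.loops, (x.range ∩ closedBall (0 : ℂ) R).Nonempty → s ≤ diam x.range →
      ∃ p ∈ P, proj p = x) :
    ∑ᶠ u ∈ d.bigLoops t, u.nestingPhase f =
      ∑ p ∈ P, (if t ≤ diam (proj p).range then (proj p).nestingPhase f else 0) := by
  classical
  rw [finsum_mem_eq_sum_of_inter_support_eq (fun u : UnbasedLoop ℂ ↦ u.nestingPhase f)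
      (t := (P.image proj).filter fun u ↦ t ≤ diam u.range) ?_]
  · rw [Finset.sum_filter, Finset.sum_image hinj]
  · ext u
    simp only [mem_inter_iff, Function.mem_support, Finset.coe_filter, Finset.mem_image, mem_setOf_eq,
      LoopConfig.mem_bigLoops_iff]
    constructor
    · rintro ⟨⟨hu, htu⟩, hne⟩
      have hR' : (u.range ∩ closedBall (0 : ℂ) R).Nonempty := by
        by_contra h
        exact hne (nestingPhase_eq_zero_of_disjoint hR h0
          (Set.disjoint_iff_inter_eq_empty.2 (Set.not_nonempty_iff_eq_empty.1 h)))
      obtain ⟨p, hp, rfl⟩ := hcov u hu hR' (hst.trans htu)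
      exact ⟨⟨⟨p, hp, rfl⟩, htu⟩, hne⟩
    · rintro ⟨⟨⟨p, hp, rfl⟩, htu⟩, hne⟩
      exact ⟨⟨hmem p hp, htu⟩, hne⟩

/-! ## §3 Averages of finite sums of bounded terms -/

/-- **Abstract averaging step for sums.**  If `W_j = Σ_{p ∈ P} a_j(p)`, `W'_j = Σ_{p ∈ P} b_j(p)` for `j < m`,
`#P ≤ N₀`, and `Σ_{j<m} |a_j(p) − b_j(p)| ≤ mK + D` for every `p ∈ P`, then
`|m⁻¹ Σ_j W_j − m⁻¹ Σ_j W'_j| ≤ N₀ (K + D/m)`. -/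
theorem ela1_abs_avg_sub_avg_le {ι : Type*} (P : Finset ι) {m N₀ : ℕ} (hm : 0 < m) (hN : P.card ≤ N₀)
    (W W' : ℕ → ℝ) (a b : ℕ → ι → ℝ) {K D : ℝ} (hK : 0 ≤ K) (hD : 0 ≤ D)
    (hW : ∀ j ∈ Finset.range m, W j = ∑ p ∈ P, a j p)
    (hW' : ∀ j ∈ Finset.range m, W' j = ∑ p ∈ P, b j p)
    (hsum : ∀ p ∈ P, ∑ j ∈ Finset.range m, |a j p - b j p| ≤ m * K + D) :
    |(∑ j ∈ Finset.range m, W j) / m - (∑ j ∈ Finset.range m, W' j) / m| ≤ N₀ * (K + D / m) := by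
  have hm' : (0 : ℝ) < m := by exact_mod_cast hm
  rw [← sub_div, ← Finset.sum_sub_distrib, abs_div, abs_of_pos hm', div_le_iff₀ hm']
  have hcardR : (P.card : ℝ) ≤ N₀ := by exact_mod_cast hN
  have hKD : 0 ≤ m * K + D := by positivity
  calc |∑ j ∈ Finset.range m, (W j - W' j)|
      ≤ ∑ j ∈ Finset.range m, |W j - W' j| := Finset.abs_sum_le_sum_abs _ _
    _ ≤ ∑ j ∈ Finset.range m, ∑ p ∈ P, |a j p - b j p| :=
        Finset.sum_le_sum fun j hj ↦ by
          rw [hW j hj, hW' j hj, ← Finset.sum_sub_distrib]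
          exact Finset.abs_sum_le_sum_abs _ _
    _ = ∑ p ∈ P, ∑ j ∈ Finset.range m, |a j p - b j p| := Finset.sum_comm
    _ ≤ ∑ p ∈ P, (m * K + D) := Finset.sum_le_sum hsum
    _ = P.card * (m * K + D) := by rw [Finset.sum_const, nsmul_eq_mul]
    _ ≤ N₀ * (m * K + D) := mul_le_mul_of_nonneg_right hcardR hKD
    _ = N₀ * (K + D / m) * m := by field_simp

/-- **Bound on an average of sums of bounded terms**: if `W_j = Σ_{p ∈ P} a_j(p)` with `|a_j(p)| ≤ K`, `#P ≤ N₀`,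
then `|m⁻¹ Σ_{j<m} W_j| ≤ N₀ K`. -/
theorem ela1_abs_avg_le {ι : Type*} (P : Finset ι) {m N₀ : ℕ} (hm : 0 < m) (hN : P.card ≤ N₀) (W : ℕ → ℝ)
    (a : ℕ → ι → ℝ) {K : ℝ} (hK : 0 ≤ K) (hW : ∀ j ∈ Finset.range m, W j = ∑ p ∈ P, a j p)
    (ha : ∀ j ∈ Finset.range m, ∀ p ∈ P, |a j p| ≤ K) :
    |(∑ j ∈ Finset.range m, W j) / m| ≤ N₀ * K := by
  have hm' : (0 : ℝ) < m := by exact_mod_cast hm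
  have hcardR : (P.card : ℝ) ≤ N₀ := by exact_mod_cast hN
  rw [abs_div, abs_of_pos hm', div_le_iff₀ hm']
  calc |∑ j ∈ Finset.range m, W j| ≤ ∑ j ∈ Finset.range m, |W j| := Finset.abs_sum_le_sum_abs _ _
    _ ≤ ∑ j ∈ Finset.range m, ∑ p ∈ P, |a j p| :=
        Finset.sum_le_sum fun j hj ↦ by
          rw [hW j hj]
          exact Finset.abs_sum_le_sum_abs _ _
    _ ≤ ∑ j ∈ Finset.range m, ∑ _p ∈ P, K :=
        Finset.sum_le_sum fun j hj ↦ Finset.sum_le_sum fun p hp ↦ ha j hj p hp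
    _ = m * (P.card * K) := by
        rw [Finset.sum_const, Finset.sum_const, Finset.card_range, nsmul_eq_mul, nsmul_eq_mul]
    _ ≤ m * (N₀ * K) := mul_le_mul_of_nonneg_left (mul_le_mul_of_nonneg_right hcardR hK) hm'.le
    _ = N₀ * K * m := by ring

/-- Squares of close bounded numbers are close: `|a|, |b| ≤ M`, `|a − b| ≤ e` give `|a² − b²| ≤ e · 2M`. -/
theorem ela1_abs_sq_sub_sq_le_of_abs_le {a b M e : ℝ} (ha : |a| ≤ M) (hb : |b| ≤ M) (hab : |a - b| ≤ e) :
    |a ^ 2 - b ^ 2| ≤ e * (2 * M) := by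
  have hM : 0 ≤ M := (abs_nonneg a).trans ha
  rw [sq_sub_sq, abs_mul]
  calc |a + b| * |a - b| ≤ (2 * M) * e :=
        mul_le_mul ((abs_add_le _ _).trans (by linarith)) hab (abs_nonneg _) (by linarith)
    _ = e * (2 * M) := mul_comm _ _

/-! ## §4 The registered comparison -/

/-- **Registered helper `ela1_comparison` (sub-goal of `el_existsLimitA1sq_of_facts`, line `Sketch` v10):
deterministic comparison of the SQUARED threshold-averaged big-loop phase sums of two `d_CN`-close
configurations** whose relevant loops (diameter `≥ η/5`, meeting `B̄(0,R+1)`) are finitely many (`≤ N₀`), inside the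
window `B(0,1/ε)`, pairwise `2ε`-SEPARATED (ribbon-free), the first configuration having `ε`-sausages of area `≤ τ`
in `B̄(0,R)` — exactly the hypotheses of `stub_closeComparison`: with `X̄(c) = m⁻¹ Σ_{j<m} Σ_{u ∈ c.bigLoops η_j} θ_u`,
`η_j = η/2 + (j+1)η/(2m)`, `|X̄(c)² − X̄(c')²| ≤ 2 N₀² (C · Leb B̄(0,R)) (Cτ + 2πCη²/m)`.  See the module docstring. -/
theorem ela1_comparison :
    ∀ (f : ℂ → ℝ) (R C : ℝ), Measurable f → (∀ z, |f z| ≤ C) → (∀ z, R < ‖z‖ → f z = 0) → ∫ z, f z = 0 →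
    ∀ (c c' : LoopConfig ℂ) (ε η τ : ℝ) (m N₀ : ℕ), 0 < ε → ε ≤ 1 → 0 < η → 8 * m * ε ≤ η → 0 ≤ τ →
    LoopConfig.IsClose ε c c' →
    ({u ∈ c.loops | (u.range ∩ Metric.closedBall (0 : ℂ) (R + 1)).Nonempty ∧
        η / 5 ≤ Metric.diam u.range}.Finite ∧
      {u ∈ c.loops | (u.range ∩ Metric.closedBall (0 : ℂ) (R + 1)).Nonempty ∧
        η / 5 ≤ Metric.diam u.range}.ncard ≤ N₀) →
    ({u ∈ c'.loops | (u.range ∩ Metric.closedBall (0 : ℂ) (R + 1)).Nonempty ∧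
        η / 5 ≤ Metric.diam u.range}.Finite ∧
      {u ∈ c'.loops | (u.range ∩ Metric.closedBall (0 : ℂ) (R + 1)).Nonempty ∧
        η / 5 ≤ Metric.diam u.range}.ncard ≤ N₀) →
    (∀ u ∈ c.loops, (u.range ∩ Metric.closedBall (0 : ℂ) (R + 1)).Nonempty → η / 5 ≤ Metric.diam u.range →
      u.range ⊆ Metric.ball (0 : ℂ) (1 / ε)) →
    (∀ u ∈ c'.loops, (u.range ∩ Metric.closedBall (0 : ℂ) (R + 1)).Nonempty → η / 5 ≤ Metric.diam u.range →
      u.range ⊆ Metric.ball (0 : ℂ) (1 / ε)) →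
    (∀ u ∈ c.loops, ∀ v ∈ c.loops, (u.range ∩ Metric.closedBall (0 : ℂ) (R + 1)).Nonempty →
      (v.range ∩ Metric.closedBall (0 : ℂ) (R + 1)).Nonempty → η / 5 ≤ Metric.diam u.range →
      η / 5 ≤ Metric.diam v.range → u ≠ v → 2 * ε < u.udist v) →
    (∀ u ∈ c'.loops, ∀ v ∈ c'.loops, (u.range ∩ Metric.closedBall (0 : ℂ) (R + 1)).Nonempty →
      (v.range ∩ Metric.closedBall (0 : ℂ) (R + 1)).Nonempty → η / 5 ≤ Metric.diam u.range →
      η / 5 ≤ Metric.diam v.range → u ≠ v → 2 * ε < u.udist v) →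
    (∀ u ∈ c.loops, (u.range ∩ Metric.closedBall (0 : ℂ) (R + 1)).Nonempty → η / 5 ≤ Metric.diam u.range →
      volume.real ({z : ℂ | Metric.infDist z u.range ≤ ε} ∩ Metric.closedBall (0 : ℂ) R) ≤ τ) →
    |((∑ j ∈ Finset.range m, ∑ᶠ u ∈ c.bigLoops (η / 2 + ((j : ℝ) + 1) * η / (2 * m)),
          u.nestingPhase f) / m) ^ 2 -
        ((∑ j ∈ Finset.range m, ∑ᶠ u ∈ c'.bigLoops (η / 2 + ((j : ℝ) + 1) * η / (2 * m)),
          u.nestingPhase f) / m) ^ 2| ≤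
      2 * N₀ ^ 2 * (C * volume.real (Metric.closedBall (0 : ℂ) R)) * (C * τ + 2 * π * C * η ^ 2 / m) := by
  intro f R C hf hC hR h0 c c' ε η τ m N₀ hε hε1 hη hmε hτ hclose hA hA' hwin hwin' hsep hsep' hsaus
  classical
  have hC0 : 0 ≤ C := nonneg_of_abs_le hC
  set K : ℝ := C * volume.real (Metric.closedBall (0 : ℂ) R) with hKdef
  have hK0 : 0 ≤ K := mul_nonneg hC0 measureReal_nonneg
  rcases Nat.eq_zero_or_pos m with rfl | hm
  · simp only [Finset.range_zero, Finset.sum_empty, Nat.cast_zero, div_zero, sub_self, abs_zero, add_zero,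
      zero_pow two_ne_zero]
    positivity
  have hm' : (0 : ℝ) < m := by exact_mod_cast hm
  have hεη : 8 * ε ≤ η := by
    have : (1 : ℝ) ≤ m := by exact_mod_cast hm
    nlinarith
  -- the matched pairs `P` (verbatim from `stub_closeComparison`)
  have hPfin : {p : UnbasedLoop ℂ × UnbasedLoop ℂ | p.1 ∈ c.loops ∧ p.2 ∈ c'.loops ∧ p.1.udist p.2 ≤ ε ∧
      ((p.1.range ∩ closedBall (0 : ℂ) R).Nonempty ∧ η / 2 ≤ diam p.1.range ∨
        (p.2.range ∩ closedBall (0 : ℂ) R).Nonempty ∧ η / 2 ≤ diam p.2.range)}.Finite := by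
    refine (hA.1.prod hA'.1).subset ?_
    rintro ⟨x, y⟩ ⟨hx, hy, hxy, hrel⟩
    have h := cc_pair_rel hε1 hεη hη.le hx hy hxy hrel
    exact Set.mk_mem_prod h.1 h.2
  obtain ⟨P, hP⟩ : ∃ P : Finset (UnbasedLoop ℂ × UnbasedLoop ℂ), ∀ p, p ∈ P ↔
      p.1 ∈ c.loops ∧ p.2 ∈ c'.loops ∧ p.1.udist p.2 ≤ ε ∧
        ((p.1.range ∩ closedBall (0 : ℂ) R).Nonempty ∧ η / 2 ≤ diam p.1.range ∨
          (p.2.range ∩ closedBall (0 : ℂ) R).Nonempty ∧ η / 2 ≤ diam p.2.range) :=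
    ⟨hPfin.toFinset, fun p ↦ by simp only [Set.Finite.mem_toFinset, mem_setOf_eq]⟩
  have hrel : ∀ p ∈ P,
      (p.1 ∈ c.loops ∧ (p.1.range ∩ closedBall (0 : ℂ) (R + 1)).Nonempty ∧ η / 5 ≤ diam p.1.range) ∧
        (p.2 ∈ c'.loops ∧ (p.2.range ∩ closedBall (0 : ℂ) (R + 1)).Nonempty ∧ η / 5 ≤ diam p.2.range) := by
    intro p hp
    obtain ⟨hx, hy, hxy, hr⟩ := (hP p).1 hp
    exact cc_pair_rel hε1 hεη hη.le hx hy hxy hr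
  -- ribbon-freeness: both projections of `P` are injective
  have hinj1 : Set.InjOn Prod.fst (↑P : Set (UnbasedLoop ℂ × UnbasedLoop ℂ)) := by
    intro p hp q hq h
    rw [Finset.mem_coe] at hp hq
    refine Prod.ext h (cc_eq_of_udist_le hsep' (hrel p hp).2 (hrel q hq).2 ((hP p).1 hp).2.2.1 ?_)
    rw [h]
    exact ((hP q).1 hq).2.2.1
  have hinj2 : Set.InjOn Prod.snd (↑P : Set (UnbasedLoop ℂ × UnbasedLoop ℂ)) := by
    intro p hp q hq h
    rw [Finset.mem_coe] at hp hq
    refine Prod.ext (cc_eq_of_udist_le hsep (hrel p hp).1 (hrel q hq).1 (x := p.2) ?_ ?_) h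
    · rw [UnbasedLoop.udist_comm]
      exact ((hP p).1 hp).2.2.1
    · rw [h, UnbasedLoop.udist_comm]
      exact ((hP q).1 hq).2.2.1
  -- at most `N₀` pairs
  have hcard : P.card ≤ N₀ := by
    have hsub : P.image Prod.fst ⊆ hA.1.toFinset := by
      intro x hx
      rw [Finset.mem_image] at hx
      obtain ⟨p, hp, rfl⟩ := hx
      rw [Set.Finite.mem_toFinset]
      exact (hrel p hp).1
    calc P.card = (P.image Prod.fst).card := (Finset.card_image_of_injOn hinj1).symm
      _ ≤ hA.1.toFinset.card := Finset.card_le_card hsub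
      _ = Set.ncard _ := (Set.ncard_eq_toFinset_card _ hA.1).symm
      _ ≤ N₀ := hA.2
  -- every contributing loop is matched
  have hcov1 : ∀ x ∈ c.loops, (x.range ∩ closedBall (0 : ℂ) R).Nonempty → η / 2 ≤ diam x.range →
      ∃ p ∈ P, Prod.fst p = x := by
    intro x hx hxR hxd
    obtain ⟨y, hy, hxy⟩ := cc_exists_partner hclose hwin hη.le hx hxR hxd
    exact ⟨(x, y), (hP _).2 ⟨hx, hy, hxy, Or.inl ⟨hxR, hxd⟩⟩, rfl⟩
  have hcov2 : ∀ y ∈ c'.loops, (y.range ∩ closedBall (0 : ℂ) R).Nonempty → η / 2 ≤ diam y.range →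
      ∃ p ∈ P, Prod.snd p = y := by
    intro y hy hyR hyd
    obtain ⟨x, hx, hyx⟩ := cc_exists_partner hclose.symm hwin' hη.le hy hyR hyd
    exact ⟨(x, y), (hP _).2 ⟨hx, hy, by rwa [UnbasedLoop.udist_comm], Or.inr ⟨hyR, hyd⟩⟩, rfl⟩
  -- thresholds are `≥ η/2`
  have hT : ∀ j : ℕ, η / 2 ≤ η / 2 + ((j : ℝ) + 1) * η / (2 * m) := fun j ↦
    le_add_of_nonneg_right (by positivity)
  -- the big-loop phase sums as finite sums over `P`
  have hW : ∀ j ∈ Finset.range m,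
      ∑ᶠ u ∈ c.bigLoops (η / 2 + ((j : ℝ) + 1) * η / (2 * m)), u.nestingPhase f =
        ∑ p ∈ P, (if η / 2 + ((j : ℝ) + 1) * η / (2 * m) ≤ diam p.1.range then p.1.nestingPhase f else 0) :=
    fun j _ ↦ ela1_bigSum_eq_sum hR h0 c P Prod.fst hinj1 (fun p hp ↦ ((hP p).1 hp).1) (hT j) hcov1
  have hW' : ∀ j ∈ Finset.range m,
      ∑ᶠ u ∈ c'.bigLoops (η / 2 + ((j : ℝ) + 1) * η / (2 * m)), u.nestingPhase f =
        ∑ p ∈ P, (if η / 2 + ((j : ℝ) + 1) * η / (2 * m) ≤ diam p.2.range then p.2.nestingPhase f else 0) :=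
    fun j _ ↦ ela1_bigSum_eq_sum hR h0 c' P Prod.snd hinj2 (fun p hp ↦ ((hP p).1 hp).2.1) (hT j) hcov2
  -- the averages are close ...
  have hdiff := ela1_abs_avg_sub_avg_le P hm hcard
    (fun j ↦ ∑ᶠ u ∈ c.bigLoops (η / 2 + ((j : ℝ) + 1) * η / (2 * m)), u.nestingPhase f)
    (fun j ↦ ∑ᶠ u ∈ c'.bigLoops (η / 2 + ((j : ℝ) + 1) * η / (2 * m)), u.nestingPhase f)
    (fun j p ↦ if η / 2 + ((j : ℝ) + 1) * η / (2 * m) ≤ diam p.1.range then p.1.nestingPhase f else 0)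
    (fun j p ↦ if η / 2 + ((j : ℝ) + 1) * η / (2 * m) ≤ diam p.2.range then p.2.nestingPhase f else 0)
    (K := C * τ) (D := 2 * π * C * η ^ 2) (by positivity) (by positivity) hW hW'
    (fun p hp ↦ ela1_sum_abs_sub_le hf hC hR hε hm hmε ((hP p).1 hp).2.2.1
      (hsaus p.1 (hrel p hp).1.1 (hrel p hp).1.2.1 (hrel p hp).1.2.2))
  -- ... and bounded by `N₀ K`
  have hterm : ∀ (t : ℝ) (u : UnbasedLoop ℂ), |(if t ≤ diam u.range then u.nestingPhase f else 0)| ≤ K := by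
    intro t u
    split_ifs
    · exact abs_nestingPhase_le_mul_volume_closedBall hC hR u
    · rw [abs_zero]; exact hK0
  have hbd := ela1_abs_avg_le P hm hcard
    (fun j ↦ ∑ᶠ u ∈ c.bigLoops (η / 2 + ((j : ℝ) + 1) * η / (2 * m)), u.nestingPhase f)
    (fun j p ↦ if η / 2 + ((j : ℝ) + 1) * η / (2 * m) ≤ diam p.1.range then p.1.nestingPhase f else 0)
    hK0 hW (fun j _ p _ ↦ hterm _ _)
  have hbd' := ela1_abs_avg_le P hm hcard
    (fun j ↦ ∑ᶠ u ∈ c'.bigLoops (η / 2 + ((j : ℝ) + 1) * η / (2 * m)), u.nestingPhase f)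
    (fun j p ↦ if η / 2 + ((j : ℝ) + 1) * η / (2 * m) ≤ diam p.2.range then p.2.nestingPhase f else 0)
    hK0 hW' (fun j _ p _ ↦ hterm _ _)
  calc |((∑ j ∈ Finset.range m, ∑ᶠ u ∈ c.bigLoops (η / 2 + ((j : ℝ) + 1) * η / (2 * m)),
            u.nestingPhase f) / m) ^ 2 -
          ((∑ j ∈ Finset.range m, ∑ᶠ u ∈ c'.bigLoops (η / 2 + ((j : ℝ) + 1) * η / (2 * m)),
            u.nestingPhase f) / m) ^ 2|
      ≤ N₀ * (C * τ + 2 * π * C * η ^ 2 / m) * (2 * (N₀ * K)) := ela1_abs_sq_sub_sq_le_of_abs_le hbd hbd' hdiff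
    _ = 2 * N₀ ^ 2 * K * (C * τ + 2 * π * C * η ^ 2 / m) := by ring

end Summit.CriticalPhenomena.CardyFormulaZ2.Cruxes.MagicFormulaT.LineSketch

end
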